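import Summits.NavierStokesRegularity.NavierStokesRegularity.Theorems.TypeICertificateLadderLadderGlue

/-!
# NavierStokesRegularity — route `TypeICertificateLadder`: the ladder exhausts the crux

Companion to `Theorems/TypeICertificateLadderLadderGlue.lean` (item stmt-NavierStokesRegularity-2887,
`LadderGlue`: all rungs `X_C`, `C > 0` ⇒ `NoTypeIBlowup`). Here the converse and the resulting
equivalence are recorded, again with every route Prop expanded verbatim and no `Theses` import:

* `typeICertificateLadder_rung_mono` — the rungs are nested: `X_C → X_{C'}` for `C' ≤ C`
  (a smaller dimensionless rate bound is a stronger hypothesis on the solution);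
* `typeICertificateLadder_rung_of_noTypeIBlowup` — the crux gives every rung (the rung hypothesis
  `√(T − t)‖u‖ ≤ C√ν` eventually is a Type-I rate with constant `C√ν`);
* `typeICertificateLadder_ladder_iff_noTypeIBlowup` — hence `(∀ C > 0, X_C) ↔ NoTypeIBlowup`:
  the certificate ladder is an EXACT exhaustion of the rank-2 crux stmt-NavierStokesRegularity-1217,
  not merely a sufficient scheme; closing the crux is the same as closing every rung, and a rung
  that fails for some `C` is a Type-I blow-up from Clay data.

Pure bookkeeping (Leray 1934 §19 / KNSS 2009 §1 for the Type-I rate vocabulary).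
-/

namespace Summit.NavierStokesRegularity.NavierStokesRegularity.Theorems

open Filter Topology

/-- **Rungs are nested** (route `TypeICertificateLadder`): if the rung `X_C` holds (eventual
dimensionless rate `√(T − t)‖u(t,x)‖ ≤ C√ν` forces a smooth extension past `T`) and `C' ≤ C`, then
the rung `X_{C'}` holds, because the `C'`-rate hypothesis implies the `C`-rate hypothesis
(`√ν ≥ 0`). [bookkeeping] -/
theorem typeICertificateLadder_rung_mono {C C' : ℝ} (hC : C' ≤ C)
    (hX : ∀ (ν T : ℝ), 0 < ν → 0 < T → ∀ (u : ℝ → EuclideanSpace ℝ (Fin 3) → EuclideanSpace ℝ (Fin 3)) (p : ℝ → EuclideanSpace ℝ (Fin 3) → ℝ), Literature.Analysis.FluidPDE.IsClassicalNSSolutionOn (Set.Ico 0 T) ν 0 u p → Literature.Analysis.FluidPDE.IsLerayHopfOn T ν 0 (u 0) u → Literature.Analysis.FluidPDE.HasRapidSpatialDecay (u 0) → (∀ᶠ t in 𝓝[<] T, ∀ x, Real.sqrt (T - t) * ‖u t x‖ ≤ C * Real.sqrt ν) → Literature.Analysis.FluidPDE.HasSmoothExtensionPast ν 0 u T) :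
    ∀ (ν T : ℝ), 0 < ν → 0 < T → ∀ (u : ℝ → EuclideanSpace ℝ (Fin 3) → EuclideanSpace ℝ (Fin 3)) (p : ℝ → EuclideanSpace ℝ (Fin 3) → ℝ), Literature.Analysis.FluidPDE.IsClassicalNSSolutionOn (Set.Ico 0 T) ν 0 u p → Literature.Analysis.FluidPDE.IsLerayHopfOn T ν 0 (u 0) u → Literature.Analysis.FluidPDE.HasRapidSpatialDecay (u 0) → (∀ᶠ t in 𝓝[<] T, ∀ x, Real.sqrt (T - t) * ‖u t x‖ ≤ C' * Real.sqrt ν) → Literature.Analysis.FluidPDE.HasSmoothExtensionPast ν 0 u T := by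
  intro ν T hν hT u p hcl hLH hdec hrate
  refine hX ν T hν hT u p hcl hLH hdec ?_
  filter_upwards [hrate] with t ht
  intro x
  exact (ht x).trans (mul_le_mul_of_nonneg_right hC (Real.sqrt_nonneg ν))

/-- **The crux gives every rung** (route `TypeICertificateLadder`): `NoTypeIBlowup`
(stmt-NavierStokesRegularity-1217, expanded verbatim) implies the rung `X_C` for every real `C`
(no sign condition needed): the eventual dimensionless bound `√(T − t)‖u(t,x)‖ ≤ C√ν` is the Type-I
rate `‖u(t,x)‖ ≤ (C√ν)/√(T − t)` for `t < T`, i.e. `IsTypeIBlowup u T` with constant `C√ν`.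
[bookkeeping; Leray 1934 §19, KNSS 2009 §1] -/
theorem typeICertificateLadder_rung_of_noTypeIBlowup
    (hI : ∀ (ν T : ℝ), 0 < ν → 0 < T → ∀ (u : ℝ → EuclideanSpace ℝ (Fin 3) → EuclideanSpace ℝ (Fin 3)) (p : ℝ → EuclideanSpace ℝ (Fin 3) → ℝ), Literature.Analysis.FluidPDE.IsClassicalNSSolutionOn (Set.Ico 0 T) ν 0 u p → Literature.Analysis.FluidPDE.IsLerayHopfOn T ν 0 (u 0) u → Literature.Analysis.FluidPDE.HasRapidSpatialDecay (u 0) → Literature.Analysis.FluidPDE.IsTypeIBlowup u T → Literature.Analysis.FluidPDE.HasSmoothExtensionPast ν 0 u T)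
    (C : ℝ) :
    ∀ (ν T : ℝ), 0 < ν → 0 < T → ∀ (u : ℝ → EuclideanSpace ℝ (Fin 3) → EuclideanSpace ℝ (Fin 3)) (p : ℝ → EuclideanSpace ℝ (Fin 3) → ℝ), Literature.Analysis.FluidPDE.IsClassicalNSSolutionOn (Set.Ico 0 T) ν 0 u p → Literature.Analysis.FluidPDE.IsLerayHopfOn T ν 0 (u 0) u → Literature.Analysis.FluidPDE.HasRapidSpatialDecay (u 0) → (∀ᶠ t in 𝓝[<] T, ∀ x, Real.sqrt (T - t) * ‖u t x‖ ≤ C * Real.sqrt ν) → Literature.Analysis.FluidPDE.HasSmoothExtensionPast ν 0 u T := by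
  intro ν T hν hT u p hcl hLH hdec hrate
  refine hI ν T hν hT u p hcl hLH hdec ⟨C * Real.sqrt ν, ?_⟩
  have hlt : ∀ᶠ t in 𝓝[<] T, t < T := self_mem_nhdsWithin
  filter_upwards [hrate, hlt] with t ht htT
  intro x
  have hTt : 0 < Real.sqrt (T - t) := Real.sqrt_pos.2 (sub_pos.2 htT)
  rw [le_div_iff₀ hTt, mul_comm]
  exact ht x

/-- **The ladder exhausts the crux** (route `TypeICertificateLadder`): the conjunction of all
rungs `X_C`, `C > 0`, is EQUIVALENT to `NoTypeIBlowup` (stmt-NavierStokesRegularity-1217), both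
expanded verbatim. Forward: `typeICertificateLadder_ladderGlue_proof` (item
stmt-NavierStokesRegularity-2887); backward: `typeICertificateLadder_rung_of_noTypeIBlowup`.
So the certificate ladder is an exact exhaustion of the crux: a rung failing for some `C > 0` is
precisely a Type-I blow-up from Clay data. [bookkeeping] -/
theorem typeICertificateLadder_ladder_iff_noTypeIBlowup :
    (∀ C : ℝ, 0 < C → ∀ (ν T : ℝ), 0 < ν → 0 < T → ∀ (u : ℝ → EuclideanSpace ℝ (Fin 3) → EuclideanSpace ℝ (Fin 3)) (p : ℝ → EuclideanSpace ℝ (Fin 3) → ℝ), Literature.Analysis.FluidPDE.IsClassicalNSSolutionOn (Set.Ico 0 T) ν 0 u p → Literature.Analysis.FluidPDE.IsLerayHopfOn T ν 0 (u 0) u → Literature.Analysis.FluidPDE.HasRapidSpatialDecay (u 0) → (∀ᶠ t in 𝓝[<] T, ∀ x, Real.sqrt (T - t) * ‖u t x‖ ≤ C * Real.sqrt ν) → Literature.Analysis.FluidPDE.HasSmoothExtensionPast ν 0 u T) ↔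
    ∀ (ν T : ℝ), 0 < ν → 0 < T → ∀ (u : ℝ → EuclideanSpace ℝ (Fin 3) → EuclideanSpace ℝ (Fin 3)) (p : ℝ → EuclideanSpace ℝ (Fin 3) → ℝ), Literature.Analysis.FluidPDE.IsClassicalNSSolutionOn (Set.Ico 0 T) ν 0 u p → Literature.Analysis.FluidPDE.IsLerayHopfOn T ν 0 (u 0) u → Literature.Analysis.FluidPDE.HasRapidSpatialDecay (u 0) → Literature.Analysis.FluidPDE.IsTypeIBlowup u T → Literature.Analysis.FluidPDE.HasSmoothExtensionPast ν 0 u T :=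
  ⟨typeICertificateLadder_ladderGlue_proof, fun hI C _ => typeICertificateLadder_rung_of_noTypeIBlowup hI C⟩

/-- **Countable ladder** (route `TypeICertificateLadder`): by nesting, the rungs at the natural
numbers `C = n + 1` already exhaust the crux — `NoTypeIBlowup` holds iff `X_{n+1}` holds for every
`n : ℕ`. This is the form in which certificates are meant to land rung by rung. [bookkeeping] -/
theorem typeICertificateLadder_natLadder_iff_noTypeIBlowup :
    (∀ n : ℕ, ∀ (ν T : ℝ), 0 < ν → 0 < T → ∀ (u : ℝ → EuclideanSpace ℝ (Fin 3) → EuclideanSpace ℝ (Fin 3)) (p : ℝ → EuclideanSpace ℝ (Fin 3) → ℝ), Literature.Analysis.FluidPDE.IsClassicalNSSolutionOn (Set.Ico 0 T) ν 0 u p → Literature.Analysis.FluidPDE.IsLerayHopfOn T ν 0 (u 0) u → Literature.Analysis.FluidPDE.HasRapidSpatialDecay (u 0) → (∀ᶠ t in 𝓝[<] T, ∀ x, Real.sqrt (T - t) * ‖u t x‖ ≤ ((n : ℝ) + 1) * Real.sqrt ν) → Literature.Analysis.FluidPDE.HasSmoothExtensionPast ν 0 u T) ↔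
    ∀ (ν T : ℝ), 0 < ν → 0 < T → ∀ (u : ℝ → EuclideanSpace ℝ (Fin 3) → EuclideanSpace ℝ (Fin 3)) (p : ℝ → EuclideanSpace ℝ (Fin 3) → ℝ), Literature.Analysis.FluidPDE.IsClassicalNSSolutionOn (Set.Ico 0 T) ν 0 u p → Literature.Analysis.FluidPDE.IsLerayHopfOn T ν 0 (u 0) u → Literature.Analysis.FluidPDE.HasRapidSpatialDecay (u 0) → Literature.Analysis.FluidPDE.IsTypeIBlowup u T → Literature.Analysis.FluidPDE.HasSmoothExtensionPast ν 0 u T := by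
  constructor
  · intro hN
    refine typeICertificateLadder_ladderGlue_proof fun C _ => ?_
    -- the rung at ⌈C⌉₊ + 1 ≥ C covers the rung at C
    exact typeICertificateLadder_rung_mono
      (by exact_mod_cast (Nat.le_ceil C).trans (le_add_of_nonneg_right zero_le_one)) (hN ⌈C⌉₊)
  · intro hI n
    exact typeICertificateLadder_rung_of_noTypeIBlowup hI _

end Summit.NavierStokesRegularity.NavierStokesRegularity.Theorems
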